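import Mathlib
import HarnessLib
import Literature.Computability.AlgebraicComplexity.BDI20ColouringGadgets
import Literature.Computability.AlgebraicComplexity.BDI20GridLikeLayeredGraphs

/-!
# Bläser–Dörfler–Ikenmeyer 2020, §8: replacing the edges of a graph by colouring gadgets preserves
# (relational) `3`-colourability — the logical half of Lemmas 26 and 29 (CCC 2021 Lemmas 8.5, 8.8)

M. Bläser, J. Dörfler, C. Ikenmeyer, *On the complexity of evaluating highest weight vectors*,
arXiv:2002.11594 (= CCC 2021, LIPIcs 200:29), §8. TeX of record `HOME/lit/src/2002.11594/fullversion.tex`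
(sha16 9e732dfe87cd0d83): Lemma 26 `lem:gridlikehardnessregular`, proof L1917–1923 ("In order to
enforce these constraints on `G_1` we construct a new graph `G_2` by replacing each edge inside any
`V_h` by the equality gadgets `H^=_1` or `H^=_2` and replacing each edge between neighbouring components
`V_u, V_v` by the inequality gadgets `H^≠_1` or `H^≠_2`. … If an edge is horizontal … we choose variant
`1` of the gadgets. If an edge is vertical we choose variant `2`. It can be easily checked that the only
way to properly `3`-color these gadgets is such that the colors of `v_1` and `v_2` are the same for the
equality gadgets and different for the inequality gadgets. Clearly `G` is now properly `3`-colorable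
iff `G_2` is properly `3`-colorable.") and Lemma 29 `lem:gridlikeethhardness`, proof L2277–2283 ("We
reduce from relational `3`-coloring on subgraphs of grids. … each equality edge is replaced by the
corresponding equality gadget and each inequality edge is replaced by the corresponding inequality
gadget. … we can decide via this reduction whether `G` allows for a relational `3`-coloring").
Numbering: arXiv flat (CCC 2021 in brackets): Lemma 26 [8.5], Lemma 28 [8.7], Lemma 29 [8.8]. Cell
val-lit, typer t20 g10; brick "D0" of the §8 programme (`HOME/np/MEMO-t21g11-BDI20-sec8-gadgets.md`,
lead-np RULING (124)): the LAYOUT-INDEPENDENT logical half of the gadget replacement. The gadgets and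
their specifications are FILE B `BDI20ColouringGadgets.lean` (`Gadgets.eqGadgetH_proper_iff`, …); the
relational grid graphs are FILE A `BDI20GridLikeLayeredGraphs.lean` (`RelGridGraph`, `IsProperRel`,
`IsRelColourable`). The GEOMETRIC half of Lemma 29 (the replaced graph is grid-like layered and, with
the multigraph versions, `8`-regular; it needs an unprinted parity mirroring rule, see
`HOME/np/NOTE-t20g10-BDI20-Lemma29-layout.md`) is FILE D proper and NOT in this file. HONEST FRAMING:
plumbing of an NP- and ETH-hardness proof about EVALUATING highest weight vectors; nothing here bears
on `VP` versus `VNP`, which is NOT proved.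

## What the source prints and how it is rendered

* The replacement step is rendered ABSTRACTLY: a `GadgetKind` is a finite graph with two ports and
  the relation `R` between the port colours it enforces, packaged WITH its proved specification
  (the four kinds `GadgetKind.eqH/eqV/neH/neV` are FILE B's gadgets with `R` = `=`, `=`, `≠`, `≠`
  and `spec` = FILE B's `…_proper_iff`); an `Assembly P ι` attaches a gadget of kind `kind g` to the
  ports `π₁ g, π₂ g : P` for every `g : ι`; the assembled graph `G₂` has vertices
  `Assembly.Vert = P ⊕ Σ g, (kind g).Inner` (the original vertices and the new inner vertices of
  every gadget), edges the images of the gadget edges under the attachment maps `Assembly.attach`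
  (`Assembly.Adj`, `Assembly.IsProper`, `isProper_iff_adj`).
* "Clearly `G` is now properly `3`-colorable iff `G_2` is properly `3`-colorable" (L1921) =
  ★ `Assembly.exists_isProper_iff : (∃ C, A.IsProper C) ↔ ∃ c : P → Fin 3, A.PortsOK c` where
  `PortsOK c` says every gadget's relation holds between its port colours; the two directions are
  `portsOK_of_isProper` (restrict, then the gadget specification) and `exists_isProper_of_portsOK`
  (glue one witness colouring per gadget — they only share port vertices).
* Lemma 29's instance: for a grid subgraph `H : RelGridGraph N` with equality / inequality edges,
  `H.assembly` replaces every equality edge by `H^=_1` (horizontal) / `H^=_2` (vertical) and every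
  inequality edge by `H^≠_1` / `H^≠_2` (`GadgetIndex`, `gadgetKind`, `IsHorizontal`), and
  ★ `assembly_exists_isProper_iff : (∃ C, H.assembly.IsProper C) ↔ H.IsRelColourable`
  (`portsOK_assembly_iff`: the port condition IS a proper relational colouring, using the symmetry
  and looplessness of `H`'s edge predicates).

Nothing in this file is a conjecture or a named fact; no `instance`, no notation; `Classical.choice`
enters through `choose` (one witness colouring per gadget).

## References
* [BlaserDorflerIkenmeyer2020] M. Bläser, J. Dörfler, C. Ikenmeyer, *On the complexity of evaluating
  highest weight vectors*, arXiv:2002.11594 / CCC 2021 — Lemma 26 proof (TeX L1917–1923), Lemma 29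
  proof (L2277–2283).
-/

namespace Literature.Computability.AlgebraicComplexity

namespace BDI2020

open Gadgets

/-! ## Gadget kinds: a finite graph with two ports and the port relation it enforces -/

/-- **A colouring gadget kind**: a graph on `k` vertices (edge list), two distinct PORT vertices
`p₁, p₂` ("`v_1` and `v_2`"), and the relation `R` it enforces between the port colours, with its
specification: the port colours `(x, y)` extend to a proper `3`-colouring of the gadget iff `R x y`
("the only way to properly `3`-color these gadgets is such that the colors of `v_1` and `v_2` are the
same for the equality gadgets and different for the inequality gadgets").
[cite: BlaserDorflerIkenmeyer2020, Lemma 26, proof (arXiv, TeX L1917–1923; = CCC 2021 Lemma 8.5)] -/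
structure GadgetKind where
  /-- number of vertices -/
  k : ℕ
  /-- the (simple) edges -/
  edges : List (Fin k × Fin k)
  /-- the port `v₁` -/
  p₁ : Fin k
  /-- the port `v₂` -/
  p₂ : Fin k
  /-- the relation forced between the colours of `v₁` and `v₂` -/
  R : Fin 3 → Fin 3 → Prop
  ports_ne : p₁ ≠ p₂
  spec : ∀ x y : Fin 3, (∃ c : Fin k → Fin 3, Proper3 edges c ∧ c p₁ = x ∧ c p₂ = y) ↔ R x y

namespace GadgetKind

/-- `H^=_1` as a gadget kind (ports `0`, `6`; relation `=`). [cite: BlaserDorflerIkenmeyer2020, Lemma 26, Fig. eqneqgadget (arXiv; = CCC 2021 Lemma 8.5)] -/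
def eqH : GadgetKind where
  k := 7
  edges := eqGadgetH.edges
  p₁ := 0
  p₂ := 6
  R := (· = ·)
  ports_ne := by decide
  spec := eqGadgetH_proper_iff

/-- `H^=_2` as a gadget kind (ports `6`, `0`; relation `=`). [cite: BlaserDorflerIkenmeyer2020, Lemma 26, Fig. eqneqgadget (arXiv; = CCC 2021 Lemma 8.5)] -/
def eqV : GadgetKind where
  k := 7
  edges := eqGadgetV.edges
  p₁ := 6
  p₂ := 0
  R := (· = ·)
  ports_ne := by decide
  spec := eqGadgetV_proper_iff

/-- `H^≠_1` as a gadget kind (ports `0`, `7`; relation `≠`). [cite: BlaserDorflerIkenmeyer2020, Lemma 26, Fig. eqneqgadget (arXiv; = CCC 2021 Lemma 8.5)] -/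
def neH : GadgetKind where
  k := 8
  edges := neGadgetH.edges
  p₁ := 0
  p₂ := 7
  R := (· ≠ ·)
  ports_ne := by decide
  spec := neGadgetH_proper_iff

/-- `H^≠_2` as a gadget kind (ports `7`, `0`; relation `≠`). [cite: BlaserDorflerIkenmeyer2020, Lemma 26, Fig. eqneqgadget (arXiv; = CCC 2021 Lemma 8.5)] -/
def neV : GadgetKind where
  k := 8
  edges := neGadgetV.edges
  p₁ := 7
  p₂ := 0
  R := (· ≠ ·)
  ports_ne := by decide
  spec := neGadgetV_proper_iff

/-- The inner (non-port) vertices of a gadget kind — the NEW vertices each replaced edge brings.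
[cite: BlaserDorflerIkenmeyer2020, Lemma 26, proof (arXiv, TeX L1917–1919; = CCC 2021 Lemma 8.5)] -/
def Inner (K : GadgetKind) : Type := {i : Fin K.k // i ≠ K.p₁ ∧ i ≠ K.p₂}

end GadgetKind

/-! ## Assemblies: a port set with gadgets attached, and the assembled graph `G₂` -/

/-- **An assembly** ("we construct a new graph `G_2` by replacing each edge … by the equality gadgets
`H^=_1` or `H^=_2` and … by the inequality gadgets `H^≠_1` or `H^≠_2`"): a type `P` of port vertices
(the vertices of the original graph), an index type `ι` of gadgets (one per replaced edge), and for
each gadget its kind and the two ports of `P` its `v₁`, `v₂` are identified with.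
[cite: BlaserDorflerIkenmeyer2020, Lemma 26, proof (arXiv, TeX L1917–1919) and Lemma 29, proof (L2278–2280) (= CCC 2021 Lemmas 8.5, 8.8)] -/
structure Assembly (P : Type*) (ι : Type*) where
  /-- the kind of gadget `g` -/
  kind : ι → GadgetKind
  /-- the port vertex playing `v₁` of gadget `g` -/
  π₁ : ι → P
  /-- the port vertex playing `v₂` of gadget `g` -/
  π₂ : ι → P

namespace Assembly

variable {P : Type*} {ι : Type*} (A : Assembly P ι)

/-- The vertices of the assembled graph `G₂`: the ports and, for every gadget, its inner vertices.
[cite: BlaserDorflerIkenmeyer2020, Lemma 26, proof (arXiv, TeX L1917–1919; = CCC 2021 Lemma 8.5)] -/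
def Vert : Type _ := P ⊕ (Σ g : ι, (A.kind g).Inner)

/-- The attachment map of gadget `g`: its local vertex `i` as a vertex of `G₂` (ports to their port
vertices, inner vertices to themselves). [cite: BlaserDorflerIkenmeyer2020, Lemma 26, proof (arXiv, TeX L1917–1919; = CCC 2021 Lemma 8.5)] -/
def attach (g : ι) (i : Fin (A.kind g).k) : A.Vert :=
  if h₁ : i = (A.kind g).p₁ then Sum.inl (A.π₁ g)
  else if h₂ : i = (A.kind g).p₂ then Sum.inl (A.π₂ g)
  else Sum.inr ⟨g, ⟨i, h₁, h₂⟩⟩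

/-- The port `v₁` of a gadget is attached to its port vertex. [cite: BlaserDorflerIkenmeyer2020, Lemma 26, proof (arXiv, TeX L1917–1921; = CCC 2021 Lemma 8.5)] -/
@[simp] theorem attach_p₁ (g : ι) : A.attach g (A.kind g).p₁ = Sum.inl (A.π₁ g) := by
  simp [attach]

/-- The port `v₂` of a gadget is attached to its port vertex. [cite: BlaserDorflerIkenmeyer2020, Lemma 26, proof (arXiv, TeX L1917–1921; = CCC 2021 Lemma 8.5)] -/
@[simp] theorem attach_p₂ (g : ι) : A.attach g (A.kind g).p₂ = Sum.inl (A.π₂ g) := by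
  simp [attach, (A.kind g).ports_ne.symm]

/-- Inner vertices of a gadget are new vertices of `G₂`. [cite: BlaserDorflerIkenmeyer2020, Lemma 26, proof (arXiv, TeX L1917–1921; = CCC 2021 Lemma 8.5)] -/
theorem attach_inner (g : ι) (i : (A.kind g).Inner) : A.attach g i.1 = Sum.inr ⟨g, i⟩ := by
  simp [attach, i.2.1, i.2.2]

/-- The edges of `G₂`: the images of the gadget edges. [cite: BlaserDorflerIkenmeyer2020, Lemma 26, proof (arXiv, TeX L1917–1919; = CCC 2021 Lemma 8.5)] -/
def Adj (v w : A.Vert) : Prop :=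
  ∃ g, ∃ e ∈ (A.kind g).edges,
    (A.attach g e.1 = v ∧ A.attach g e.2 = w) ∨ (A.attach g e.1 = w ∧ A.attach g e.2 = v)

/-- A proper `3`-colouring of `G₂`: every gadget edge is bichromatic. [cite: BlaserDorflerIkenmeyer2020, Lemma 26, proof ("`G_2` is properly `3`-colorable") (arXiv, TeX L1921; = CCC 2021 Lemma 8.5)] -/
def IsProper (C : A.Vert → Fin 3) : Prop :=
  ∀ g, ∀ e ∈ (A.kind g).edges, C (A.attach g e.1) ≠ C (A.attach g e.2)

/-- Gadget-wise properness is properness for the edge relation of `G₂`. [cite: BlaserDorflerIkenmeyer2020, Lemma 26, proof (arXiv, TeX L1917–1921; = CCC 2021 Lemma 8.5)] -/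
theorem isProper_iff_adj (C : A.Vert → Fin 3) : A.IsProper C ↔ ∀ v w, A.Adj v w → C v ≠ C w := by
  constructor
  · rintro h v w ⟨g, e, he, (⟨rfl, rfl⟩ | ⟨rfl, rfl⟩)⟩
    · exact h g e he
    · exact (h g e he).symm
  · intro h g e he
    exact h _ _ ⟨g, e, he, Or.inl ⟨rfl, rfl⟩⟩

/-- A colouring of the ports satisfies the assembly when every gadget's port relation holds ("properly
`3`-colorable" for the original graph with equality / inequality edges).
[cite: BlaserDorflerIkenmeyer2020, Lemma 26, proof (arXiv, TeX L1921) and §8 before Lemma 28 (L2078) (= CCC 2021 Lemma 8.5, §8)] -/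
def PortsOK (c : P → Fin 3) : Prop := ∀ g, (A.kind g).R (c (A.π₁ g)) (c (A.π₂ g))

/-- Restricting a proper colouring of `G₂` to a gadget gives a proper colouring of the gadget with the
port colours of its port vertices. [cite: BlaserDorflerIkenmeyer2020, Lemma 26, proof (arXiv, TeX L1921–1923; = CCC 2021 Lemma 8.5)] -/
theorem portsOK_of_isProper {C : A.Vert → Fin 3} (hC : A.IsProper C) :
    A.PortsOK (fun p => C (Sum.inl p)) := by
  intro g
  rw [← (A.kind g).spec]
  exact ⟨fun i => C (A.attach g i), fun e he => hC g e he, by simp, by simp⟩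

/-- Gluing: a port colouring satisfying every gadget's relation extends, gadget by gadget, to a proper
colouring of `G₂`. [cite: BlaserDorflerIkenmeyer2020, Lemma 26, proof (arXiv, TeX L1921–1923; = CCC 2021 Lemma 8.5)] -/
theorem exists_isProper_of_portsOK {c : P → Fin 3} (hc : A.PortsOK c) :
    ∃ C : A.Vert → Fin 3, A.IsProper C ∧ ∀ p, C (Sum.inl p) = c p := by
  have hw : ∀ g, ∃ w : Fin (A.kind g).k → Fin 3,
      Proper3 (A.kind g).edges w ∧ w (A.kind g).p₁ = c (A.π₁ g) ∧ w (A.kind g).p₂ = c (A.π₂ g) :=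
    fun g => ((A.kind g).spec _ _).2 (hc g)
  choose w hw using hw
  let C : A.Vert → Fin 3 := fun v => match v with
    | Sum.inl p => c p
    | Sum.inr ⟨g, i⟩ => w g i.1
  have hCw : ∀ g (i : Fin (A.kind g).k), C (A.attach g i) = w g i := by
    intro g i
    by_cases h₁ : i = (A.kind g).p₁
    · subst h₁; rw [attach_p₁]; exact (hw g).2.1.symm
    by_cases h₂ : i = (A.kind g).p₂
    · subst h₂; rw [attach_p₂]; exact (hw g).2.2.symm
    rw [show i = (⟨i, h₁, h₂⟩ : (A.kind g).Inner).1 from rfl, attach_inner]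
  refine ⟨C, fun g e he => ?_, fun p => rfl⟩
  rw [hCw, hCw]
  exact (hw g).1 e he

/-- **Lemmas 26/29, the logical half: "`G` is properly `3`-colorable iff `G_2` is properly
`3`-colorable".** The assembled graph has a proper `3`-colouring iff the ports have a colouring
satisfying every gadget's port relation (equal along equality gadgets, different along inequality
gadgets). [cite: BlaserDorflerIkenmeyer2020, Lemma 26, proof (arXiv, TeX L1921) and Lemma 29, proof (L2278–2283) (= CCC 2021 Lemmas 8.5, 8.8)] -/
theorem exists_isProper_iff : (∃ C : A.Vert → Fin 3, A.IsProper C) ↔ ∃ c : P → Fin 3, A.PortsOK c := by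
  constructor
  · rintro ⟨C, hC⟩
    exact ⟨_, A.portsOK_of_isProper hC⟩
  · rintro ⟨c, hc⟩
    obtain ⟨C, hC, -⟩ := A.exists_isProper_of_portsOK hc
    exact ⟨C, hC⟩

end Assembly

/-! ## The assembly of a grid subgraph with equality / inequality edges (Lemma 29's `G₂`) -/

namespace RelGridGraph

variable {N : ℕ} (H : RelGridGraph N)

/-- The gadgets of Lemma 29's `G₂`: one per equality edge (`true`) and one per inequality edge
(`false`) of `H`, each edge taken once with its smaller end first.
[cite: BlaserDorflerIkenmeyer2020, Lemma 29, proof ("each equality edge is replaced by the corresponding equality gadget and each inequality edge is replaced by the corresponding inequality gadget") (arXiv, TeX L2278–2280; = CCC 2021 Lemma 8.8)] -/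
def GadgetIndex : Type :=
  {x : (Fin N × Fin N) × Bool //
    x.1.1 < x.1.2 ∧ (if x.2 then H.eqAdj x.1.1 x.1.2 else H.neAdj x.1.1 x.1.2) = true}

/-- An edge of the grid subgraph is horizontal when its ends lie in the same row.
[cite: BlaserDorflerIkenmeyer2020, Lemma 26, proof ("If an edge is horizontal … we choose variant 1 … If an edge is vertical we choose variant 2") (arXiv, TeX L1919–1920; = CCC 2021 Lemma 8.5)] -/
abbrev IsHorizontal (u v : Fin N) : Prop := (H.pos u).2 = (H.pos v).2

/-- The kind of the gadget replacing an edge: equality / inequality by the edge's label, variant `1` /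
`2` by horizontal / vertical. [cite: BlaserDorflerIkenmeyer2020, Lemma 26, proof (arXiv, TeX L1917–1920) and Lemma 29, proof (L2278–2280) (= CCC 2021 Lemmas 8.5, 8.8)] -/
def gadgetKind (g : H.GadgetIndex) : GadgetKind :=
  if g.1.2 then (if H.IsHorizontal g.1.1.1 g.1.1.2 then GadgetKind.eqH else GadgetKind.eqV)
  else (if H.IsHorizontal g.1.1.1 g.1.1.2 then GadgetKind.neH else GadgetKind.neV)

/-- **Lemma 29's `G₂` as an assembly** over the vertices of `H`.
[cite: BlaserDorflerIkenmeyer2020, Lemma 29, proof (arXiv, TeX L2278–2280; = CCC 2021 Lemma 8.8)] -/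
def assembly : Assembly (Fin N) H.GadgetIndex where
  kind := H.gadgetKind
  π₁ g := g.1.1.1
  π₂ g := g.1.1.2

/-- The relation enforced by the gadget of an edge: `=` for equality edges, `≠` for inequality edges. [cite: BlaserDorflerIkenmeyer2020, Lemma 26, proof (TeX L1917–1920) and Lemma 29, proof (TeX L2278–2280) (arXiv; = CCC 2021 Lemmas 8.5, 8.8)] -/
theorem gadgetKind_R (g : H.GadgetIndex) (x y : Fin 3) :
    (H.gadgetKind g).R x y ↔ (if g.1.2 then x = y else x ≠ y) := by
  unfold gadgetKind
  split_ifs <;> rfl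

/-- The port condition of the assembly is exactly a proper relational `3`-colouring of `H`.
[cite: BlaserDorflerIkenmeyer2020, §8 before Lemma 28 (arXiv, TeX L2078) and Lemma 29, proof (L2278–2283) (= CCC 2021 §8, Lemma 8.8)] -/
theorem portsOK_assembly_iff (c : Fin N → Fin 3) : H.assembly.PortsOK c ↔ H.IsProperRel c := by
  constructor
  · intro h
    have key : ∀ u v : Fin N, u < v →
        (H.eqAdj u v = true → c u = c v) ∧ (H.neAdj u v = true → c u ≠ c v) := by
      intro u v huv
      constructor
      · intro he
        have := h ⟨((u, v), true), huv, by simpa using he⟩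
        simpa [Assembly.PortsOK, assembly, gadgetKind_R] using this
      · intro hn
        have := h ⟨((u, v), false), huv, by simpa using hn⟩
        simpa [Assembly.PortsOK, assembly, gadgetKind_R] using this
    constructor
    · intro u v he
      rcases lt_trichotomy u v with huv | rfl | hvu
      · exact (key u v huv).1 he
      · rfl
      · rw [H.eqAdj_comm] at he
        exact ((key v u hvu).1 he).symm
    · intro u v hn
      rcases lt_trichotomy u v with huv | rfl | hvu
      · exact (key u v huv).2 hn
      · exact absurd hn (by simp [H.neAdj_self])
      · rw [H.neAdj_comm] at hn
        exact ((key v u hvu).2 hn).symm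
  · rintro ⟨hE, hN⟩ ⟨⟨⟨u, v⟩, b⟩, huv, hb⟩
    show (H.gadgetKind _).R (c u) (c v)
    rw [gadgetKind_R]
    cases b
    · simp only [Bool.false_eq_true, ↓reduceIte] at hb ⊢
      exact hN u v hb
    · simp only [↓reduceIte] at hb ⊢
      exact hE u v hb

/-- **Lemma 29, logical half:** the gadget graph `G₂` of a grid subgraph `H` with equality and
inequality edges is properly `3`-colourable iff `H` is relationally `3`-colourable.
[cite: BlaserDorflerIkenmeyer2020, Lemma 29, proof ("we can decide via this reduction whether `G` allows for a relational `3`-coloring") (arXiv, TeX L2278–2283; = CCC 2021 Lemma 8.8)] -/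
theorem assembly_exists_isProper_iff :
    (∃ C : H.assembly.Vert → Fin 3, H.assembly.IsProper C) ↔ H.IsRelColourable := by
  rw [Assembly.exists_isProper_iff]
  simp only [portsOK_assembly_iff]
  rfl

end RelGridGraph

end BDI2020

end Literature.Computability.AlgebraicComplexity
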